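import Mathlib
import Literature.NumberTheory.Automorphic.TwistedQuotientPullbackCalculus
import HarnessLib

/-!
# Transfer of polynomial growth, II: the average over the cosets of a finite-index subgroup, and
# the finite index of an arithmetic subgroup covering the space by translates of reduced sets

Topic `NumberTheory/Automorphic`; namespace `Literature.NumberTheory.Automorphic`, grouping
sub-namespace `TwistedQuotient` (sequel of `TwistedQuotientGrowthTransfer`).  Theorems only.  The
setting is the abstract one of that file: a group `Λ` acting on the real normed space `W` by
`act : Λ →* (W →L[ℝ] W)` preserving an open `X`, a gauge `E ≥ 1` distorted boundedly by each
`act g`, "reduced sets" `R ⊆ W`.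

* `growth_average` — if `β₁` has `C¹` bounds polynomial in `E` on every translate
  `{y ∈ X : g · y ∈ R₁}`, `g ∈ Λ`, then so has the average
  `β₂ = [G:H]⁻¹ ∑_{c ∈ G ⧸ H} c.out ⋆ β₁` of its twisted pull-backs (`G ≤ Λ`, `H ≤ G` of finite
  index), on every `{x ∈ X : δ⁻¹ · x ∈ R₁}`, with bounds in applied form
  (`(δ⁻¹ c.out) · (c.out⁻¹ · x) = δ⁻¹ · x` and `E(c.out⁻¹ · x) ≤ d_c E(x)`);
* `finiteIndex_range_of_cover` — if `P ≤ Λ` has `(P ∩ G)` of finite index in `G`, `φ : Γ →* G` lands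
  in `P`, the translates `(φ γ · t) · R₀` (`t ∈ T` finite) cover a non-empty `G`-stable `X`, and for
  every `t` only finitely many `s ∈ P ∩ G` move `t · R₀` onto `R₀` (Siegel property), then `φ(Γ)` has
  finite index in `G`: `G ∩ P ⊆ φ(Γ) · F` for a finite `F` (apply the cover to `u⁻¹ · x₀` for a
  reduced base point `x₀`).

## References

* A. Borel, *Regularization theorems in Lie algebra cohomology. Applications*, Duke Math. J. 50
  (1983), §3.5. [Borel1983Regularization]
* A. Borel, *Introduction aux groupes arithmétiques*, Hermann (1969), §13, §15. [Borel1969]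
* K. S. Brown, *Cohomology of groups*, GTM 87 (1982), III §9 (transfer). [Brown1982CohomologyGroups]
-/

noncomputable section

open Set Filter
open scoped Topology

namespace Literature.NumberTheory.Automorphic

namespace TwistedQuotient

variable {Λ : Type} [Group Λ]
  {V : Type} [NormedAddCommGroup V] [NormedSpace ℂ V] [FiniteDimensional ℂ V]
  {W : Type} [NormedAddCommGroup W] [NormedSpace ℝ W]

/-- **Polynomial `C¹` growth of the coset average** `β₂ = [G:H]⁻¹ ∑_c c.out ⋆ β₁` on a translate
`δ · R₁` of a reduced set, from the growth of `β₁` on all translates: each summand is a fixed twisted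
pull-back, `(δ⁻¹ c.out) · (c.out⁻¹ · x) = δ⁻¹ · x`, and `E(c.out⁻¹ · x) ≤ d_c E(x)`; the bounds are
given in applied form. [cite: Borel1983Regularization, §3.5] -/
theorem growth_average (act : Λ →* (W →L[ℝ] W)) (G : Subgroup Λ) (Hc : Subgroup G) [Hc.FiniteIndex]
    [Fintype (G ⧸ Hc)] (ρ : Representation ℂ G V) {X : Set W} (hXo : IsOpen X)
    (hX : ∀ g : Λ, MapsTo (act g) X X) (E : W → ℝ) (hE1 : ∀ x, 1 ≤ E x)
    (hEact : ∀ g : Λ, ∃ d : ℝ, 0 ≤ d ∧ ∀ x, E (act g x) ≤ d * E x)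
    {R₁ : Set W} {q : ℕ} (β₁ : W → W [⋀^Fin q]→L[ℝ] V) (hβ₁s : DifferentiableOn ℝ β₁ X)
    (hgr : ∀ g : Λ, ∃ (C : ℝ) (k : ℕ), ∀ y ∈ X, act g y ∈ R₁ →
      ‖β₁ y‖ ≤ C * E y ^ k ∧ ‖fderiv ℝ β₁ y‖ ≤ C * E y ^ k)
    (β₂ : W → W [⋀^Fin q]→L[ℝ] V)
    (hβ₂ : ∀ x, β₂ x = ((Hc.index : ℝ)⁻¹) • ∑ c : G ⧸ Hc,
      actAlt ρ (act.comp G.subtype) c.out q (β₁ ((act.comp G.subtype) c.out⁻¹ x)))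
    (δ : Λ) :
    ∃ (C : ℝ) (k : ℕ), ∀ x ∈ X, act δ⁻¹ x ∈ R₁ → ∀ (v : Fin q → W) (w' : W),
      ‖β₂ x v‖ ≤ C * E x ^ k * ∏ i, ‖v i‖ ∧
      ‖fderiv ℝ β₂ x w' v‖ ≤ C * E x ^ k * ‖w'‖ * ∏ i, ‖v i‖ := by
  classical
  have ha : ∀ (g : G) (x : W), (act.comp G.subtype) g x = act (g : Λ) x := fun _ _ => rfl
  have hmaps : ∀ g : G, MapsTo ((act.comp G.subtype) g) X X := fun g => hX (g : Λ)
  -- per-coset constants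
  have hc : ∀ c : G ⧸ Hc, ∃ (C : ℝ) (k : ℕ), ∀ y ∈ X, act (δ⁻¹ * ((c.out : G) : Λ)) y ∈ R₁ →
      ‖β₁ y‖ ≤ C * E y ^ k ∧ ‖fderiv ℝ β₁ y‖ ≤ C * E y ^ k := fun c => hgr _
  choose Cc kc hCk using hc
  choose d hd0 hd using hEact
  -- notation for the constant of a coset
  have hKc : ∀ c : G ⧸ Hc, 0 ≤ ‖ρCLM ρ c.out‖ * (1 + ‖(act.comp G.subtype) c.out⁻¹‖) ^ (q + 1) *
      (|Cc c| * d ((c.out⁻¹ : G) : Λ) ^ kc c) := fun c =>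
    mul_nonneg (mul_nonneg (norm_nonneg _) (pow_nonneg (add_nonneg zero_le_one (norm_nonneg _)) _))
      (mul_nonneg (abs_nonneg _) (pow_nonneg (hd0 _) _))
  refine ⟨∑ c : G ⧸ Hc, ‖ρCLM ρ c.out‖ * (1 + ‖(act.comp G.subtype) c.out⁻¹‖) ^ (q + 1) *
      (|Cc c| * d ((c.out⁻¹ : G) : Λ) ^ kc c), ∑ c : G ⧸ Hc, kc c, fun x hx hxred v w' => ?_⟩
  have hEx1 : 1 ≤ E x := hE1 x
  have hEx0 : 0 ≤ E x := zero_le_one.trans hEx1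
  have hP : 0 ≤ ∏ i, ‖v i‖ := Finset.prod_nonneg fun i _ => norm_nonneg _
  have hr1 : |((Hc.index : ℝ)⁻¹)| ≤ 1 := by
    rw [abs_of_nonneg (inv_nonneg.2 (Nat.cast_nonneg _))]
    exact inv_le_one_of_one_le₀ (by exact_mod_cast Nat.one_le_iff_ne_zero.2 Subgroup.FiniteIndex.index_ne_zero)
  -- per coset: the point `y_c = c.out⁻¹ · x` and its bounds
  have hyc : ∀ c : G ⧸ Hc, (act.comp G.subtype) c.out⁻¹ x ∈ X := fun c => hmaps _ hx
  have hredc : ∀ c : G ⧸ Hc, act (δ⁻¹ * ((c.out : G) : Λ)) ((act.comp G.subtype) c.out⁻¹ x) ∈ R₁ := by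
    intro c
    have h : act (δ⁻¹ * ((c.out : G) : Λ)) ((act.comp G.subtype) c.out⁻¹ x) = act δ⁻¹ x := by
      rw [map_mul, mul_apply_eq_comp, ← ha, act_apply_inv]
    rw [h]
    exact hxred
  -- `E(y_c)^{k_c} ≤ d_c^{k_c} E^{Σ k}`
  have hEc : ∀ c : G ⧸ Hc, ∀ {u : ℝ}, u ≤ Cc c * E ((act.comp G.subtype) c.out⁻¹ x) ^ kc c →
      u ≤ |Cc c| * d ((c.out⁻¹ : G) : Λ) ^ kc c * E x ^ (∑ c : G ⧸ Hc, kc c) := by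
    intro c u hu
    have h1 : E ((act.comp G.subtype) c.out⁻¹ x) ≤ d ((c.out⁻¹ : G) : Λ) * E x := hd _ _
    have hy1 : 1 ≤ E ((act.comp G.subtype) c.out⁻¹ x) := hE1 _
    have hkK : kc c ≤ ∑ c : G ⧸ Hc, kc c := Finset.single_le_sum (fun _ _ => Nat.zero_le _) (Finset.mem_univ c)
    calc u ≤ _ := hu
      _ ≤ |Cc c| * E ((act.comp G.subtype) c.out⁻¹ x) ^ kc c :=
          mul_le_mul_of_nonneg_right (le_abs_self _) (pow_nonneg (zero_le_one.trans hy1) _)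
      _ ≤ |Cc c| * (d ((c.out⁻¹ : G) : Λ) * E x) ^ kc c :=
          mul_le_mul_of_nonneg_left (pow_le_pow_left₀ (zero_le_one.trans hy1) h1 _) (abs_nonneg _)
      _ = |Cc c| * d ((c.out⁻¹ : G) : Λ) ^ kc c * E x ^ kc c := by rw [mul_pow, mul_assoc]
      _ ≤ _ := mul_le_mul_of_nonneg_left (pow_le_pow_right₀ hEx1 hkK)
          (mul_nonneg (abs_nonneg _) (pow_nonneg (hd0 _) _))
  -- `‖a‖^j ≤ (1+‖a‖)^{q+1}` for `j ≤ q + 1`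
  have hapow : ∀ (c : G ⧸ Hc) (j : ℕ), j ≤ q + 1 →
      ‖(act.comp G.subtype) c.out⁻¹‖ ^ j ≤ (1 + ‖(act.comp G.subtype) c.out⁻¹‖) ^ (q + 1) := by
    intro c j hj
    exact (pow_le_pow_left₀ (norm_nonneg _) (le_add_of_nonneg_left zero_le_one) j).trans
      (pow_le_pow_right₀ (le_add_of_nonneg_right (norm_nonneg _)) hj)
  -- the bound of one summand, for a form `Mf` at `y_c` with `‖Mf‖ ≤ ‖a c.out⁻¹‖^e R (C_c E(y_c)^{k_c})`
  have hterm : ∀ (c : G ⧸ Hc) (Mf : W [⋀^Fin q]→L[ℝ] V) (R : ℝ) (e : ℕ), 0 ≤ R → e + q ≤ q + 1 →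
      ‖Mf‖ ≤ ‖(act.comp G.subtype) c.out⁻¹‖ ^ e * R *
        (Cc c * E ((act.comp G.subtype) c.out⁻¹ x) ^ kc c) →
      ‖actAlt ρ (act.comp G.subtype) c.out q Mf v‖ ≤
        ‖ρCLM ρ c.out‖ * (1 + ‖(act.comp G.subtype) c.out⁻¹‖) ^ (q + 1) *
          (|Cc c| * d ((c.out⁻¹ : G) : Λ) ^ kc c) * E x ^ (∑ c : G ⧸ Hc, kc c) * R * ∏ i, ‖v i‖ := by
    intro c Mf R e hR he hMf
    have hMf' : ‖Mf‖ ≤ ‖(act.comp G.subtype) c.out⁻¹‖ ^ e * R *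
        (|Cc c| * d ((c.out⁻¹ : G) : Λ) ^ kc c * E x ^ (∑ c : G ⧸ Hc, kc c)) := by
      have h0 : 0 ≤ ‖(act.comp G.subtype) c.out⁻¹‖ ^ e * R := mul_nonneg (pow_nonneg (norm_nonneg _) _) hR
      by_cases hR0 : ‖(act.comp G.subtype) c.out⁻¹‖ ^ e * R = 0
      · rw [hR0, zero_mul] at hMf ⊢
        exact hMf
      · have hpos : 0 < ‖(act.comp G.subtype) c.out⁻¹‖ ^ e * R := lt_of_le_of_ne h0 (Ne.symm hR0)
        have := hEc c (u := ‖Mf‖ / (‖(act.comp G.subtype) c.out⁻¹‖ ^ e * R))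
          (by rw [div_le_iff₀' hpos]; exact hMf)
        rwa [div_le_iff₀' hpos] at this
    calc ‖actAlt ρ (act.comp G.subtype) c.out q Mf v‖
        ≤ ‖ρCLM ρ c.out‖ * ‖Mf‖ * ∏ i, (‖(act.comp G.subtype) c.out⁻¹‖ * ‖v i‖) :=
          norm_actAlt_apply_le ρ (act.comp G.subtype) _ _ _ _
      _ = ‖ρCLM ρ c.out‖ * (‖(act.comp G.subtype) c.out⁻¹‖ ^ q * ‖Mf‖) * ∏ i, ‖v i‖ := by
          rw [Finset.prod_mul_distrib, Finset.prod_const, Finset.card_univ, Fintype.card_fin]; ring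
      _ ≤ ‖ρCLM ρ c.out‖ * (‖(act.comp G.subtype) c.out⁻¹‖ ^ q *
          (‖(act.comp G.subtype) c.out⁻¹‖ ^ e * R *
            (|Cc c| * d ((c.out⁻¹ : G) : Λ) ^ kc c * E x ^ (∑ c : G ⧸ Hc, kc c)))) * ∏ i, ‖v i‖ :=
          mul_le_mul_of_nonneg_right (mul_le_mul_of_nonneg_left
            (mul_le_mul_of_nonneg_left hMf' (pow_nonneg (norm_nonneg _) _)) (norm_nonneg _)) hP
      _ = ‖ρCLM ρ c.out‖ * ‖(act.comp G.subtype) c.out⁻¹‖ ^ (e + q) *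
          (|Cc c| * d ((c.out⁻¹ : G) : Λ) ^ kc c) * E x ^ (∑ c : G ⧸ Hc, kc c) * R * ∏ i, ‖v i‖ := by
          rw [pow_add]; ring
      _ ≤ _ :=
          mul_le_mul_of_nonneg_right (mul_le_mul_of_nonneg_right (mul_le_mul_of_nonneg_right
            (mul_le_mul_of_nonneg_right (mul_le_mul_of_nonneg_left (hapow c _ he) (norm_nonneg _))
              (mul_nonneg (abs_nonneg _) (pow_nonneg (hd0 _) _))) (pow_nonneg hEx0 _)) hR) hP
  refine ⟨?_, ?_⟩
  · -- the form itself
    have hsum : β₂ x v = (Hc.index : ℝ)⁻¹ • ∑ c : G ⧸ Hc,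
        actAlt ρ (act.comp G.subtype) c.out q (β₁ ((act.comp G.subtype) c.out⁻¹ x)) v := by
      rw [hβ₂, ContinuousAlternatingMap.smul_apply, ContinuousAlternatingMap.sum_apply]
    rw [hsum, _root_.norm_smul, Real.norm_eq_abs]
    have hS : ∑ c : G ⧸ Hc, ‖actAlt ρ (act.comp G.subtype) c.out q (β₁ ((act.comp G.subtype) c.out⁻¹ x)) v‖ ≤
        (∑ c : G ⧸ Hc, ‖ρCLM ρ c.out‖ * (1 + ‖(act.comp G.subtype) c.out⁻¹‖) ^ (q + 1) *
          (|Cc c| * d ((c.out⁻¹ : G) : Λ) ^ kc c)) * E x ^ (∑ c : G ⧸ Hc, kc c) * ∏ i, ‖v i‖ := by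
      rw [Finset.sum_mul, Finset.sum_mul]
      refine Finset.sum_le_sum fun c _ => ?_
      have h := hterm c (β₁ ((act.comp G.subtype) c.out⁻¹ x)) 1 0 zero_le_one (by omega)
        (by rw [pow_zero, one_mul, one_mul]; exact (hCk c _ (hyc c) (hredc c)).1)
      rw [mul_one] at h
      exact h
    calc |((Hc.index : ℝ)⁻¹)| * ‖∑ c : G ⧸ Hc,
          actAlt ρ (act.comp G.subtype) c.out q (β₁ ((act.comp G.subtype) c.out⁻¹ x)) v‖
        ≤ 1 * ∑ c : G ⧸ Hc, ‖actAlt ρ (act.comp G.subtype) c.out q (β₁ ((act.comp G.subtype) c.out⁻¹ x)) v‖ :=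
          mul_le_mul hr1 (norm_sum_le _ _) (norm_nonneg _) zero_le_one
      _ ≤ _ := by rw [one_mul]; exact hS
  · -- the derivative
    have hdiff : ∀ c : G ⧸ Hc, DifferentiableAt ℝ β₁ ((act.comp G.subtype) c.out⁻¹ x) := fun c =>
      (hβ₁s _ (hyc c)).differentiableAt (hXo.mem_nhds (hyc c))
    have hfun : β₂ = fun y => (Hc.index : ℝ)⁻¹ • ∑ c : G ⧸ Hc,
        actAlt ρ (act.comp G.subtype) c.out q (β₁ ((act.comp G.subtype) c.out⁻¹ y)) := funext hβ₂
    have hD : fderiv ℝ β₂ x w' = (Hc.index : ℝ)⁻¹ • ∑ c : G ⧸ Hc,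
        actAlt ρ (act.comp G.subtype) c.out q
          (fderiv ℝ β₁ ((act.comp G.subtype) c.out⁻¹ x) ((act.comp G.subtype) c.out⁻¹ w')) := by
      have hH := (HasFDerivAt.fun_sum (u := (Finset.univ : Finset (G ⧸ Hc))) fun c _ =>
        hasFDerivAt_actAlt_comp ρ (act.comp G.subtype) c.out (r := q) (hdiff c).hasFDerivAt).fun_const_smul
          ((Hc.index : ℝ)⁻¹)
      rw [hfun, hH.fderiv, _root_.smul_apply, _root_.sum_apply]
      rfl
    rw [hD, ContinuousAlternatingMap.smul_apply, ContinuousAlternatingMap.sum_apply, _root_.norm_smul,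
      Real.norm_eq_abs]
    have hS : ∑ c : G ⧸ Hc, ‖actAlt ρ (act.comp G.subtype) c.out q
        (fderiv ℝ β₁ ((act.comp G.subtype) c.out⁻¹ x) ((act.comp G.subtype) c.out⁻¹ w')) v‖ ≤
        (∑ c : G ⧸ Hc, ‖ρCLM ρ c.out‖ * (1 + ‖(act.comp G.subtype) c.out⁻¹‖) ^ (q + 1) *
          (|Cc c| * d ((c.out⁻¹ : G) : Λ) ^ kc c)) * E x ^ (∑ c : G ⧸ Hc, kc c) * ‖w'‖ * ∏ i, ‖v i‖ := by
      rw [Finset.sum_mul, Finset.sum_mul, Finset.sum_mul]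
      refine Finset.sum_le_sum fun c _ => ?_
      refine hterm c _ ‖w'‖ 1 (norm_nonneg _) (by omega) ?_
      calc ‖fderiv ℝ β₁ ((act.comp G.subtype) c.out⁻¹ x) ((act.comp G.subtype) c.out⁻¹ w')‖
          ≤ ‖fderiv ℝ β₁ ((act.comp G.subtype) c.out⁻¹ x)‖ * ‖(act.comp G.subtype) c.out⁻¹ w'‖ :=
            ContinuousLinearMap.le_opNorm _ _
        _ ≤ (Cc c * E ((act.comp G.subtype) c.out⁻¹ x) ^ kc c) * (‖(act.comp G.subtype) c.out⁻¹‖ * ‖w'‖) :=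
            mul_le_mul (hCk c _ (hyc c) (hredc c)).2 (((act.comp G.subtype) c.out⁻¹).le_opNorm w')
              (norm_nonneg _) ((norm_nonneg _).trans (hCk c _ (hyc c) (hredc c)).1)
        _ = _ := by rw [pow_one]; ring
    calc |((Hc.index : ℝ)⁻¹)| * ‖∑ c : G ⧸ Hc, actAlt ρ (act.comp G.subtype) c.out q
          (fderiv ℝ β₁ ((act.comp G.subtype) c.out⁻¹ x) ((act.comp G.subtype) c.out⁻¹ w')) v‖
        ≤ 1 * ∑ c : G ⧸ Hc, ‖actAlt ρ (act.comp G.subtype) c.out q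
            (fderiv ℝ β₁ ((act.comp G.subtype) c.out⁻¹ x) ((act.comp G.subtype) c.out⁻¹ w')) v‖ :=
          mul_le_mul hr1 (norm_sum_le _ _) (norm_nonneg _) zero_le_one
      _ ≤ _ := by rw [one_mul]; exact hS

omit [NormedSpace ℝ W] in
/-- **An arithmetic subgroup covering the space by finitely many translates of a reduced set has
finite index in the rational stabiliser.**  Abstractly: `P ≤ Λ` with `P ∩ G` of finite index in
`G` (the totally positive elements), `φ : Γ →* G` landing in `P`, the translates `(φ γ · t) · R₀`
(`γ ∈ Γ`, `t ∈ T`) covering a non-empty `Λ`-stable `X`, and the Siegel property (for each `t` only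
finitely many `s ∈ P ∩ G` with `(s t) · R₀ ∩ R₀ ≠ ∅` inside `X`); then `φ(Γ)` has finite index in
`G` (`G ∩ P ⊆ φ(Γ) · F`, `F` finite, by covering `u⁻¹ · x₀` for a reduced base point `x₀`).
[cite: Borel1969, §13 and §15] -/
theorem finiteIndex_range_of_cover {W' : Type} [NormedAddCommGroup W'] [NormedSpace ℝ W']
    (act : Λ →* (W' →L[ℝ] W')) {X : Set W'}
    (hX : ∀ g : Λ, MapsTo (act g) X X) (hXne : X.Nonempty) (G P : Subgroup Λ)
    [hP : (P.subgroupOf G).FiniteIndex] {Γ : Type} [Group Γ] (φ : Γ →* G)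
    (hφP : ∀ γ : Γ, ((φ γ : G) : Λ) ∈ P) {R₀ : Set W'} (T : Finset Λ)
    (hcov : ∀ H ∈ X, ∃ (γ : Γ) (t : Λ), t ∈ T ∧ act (((φ γ : G) : Λ) * t)⁻¹ H ∈ R₀)
    (hfin : ∀ t ∈ T, Set.Finite {s : P | (s : Λ) ∈ G ∧ ∃ H ∈ X,
      act ((s : Λ) * t)⁻¹ H ∈ R₀ ∧ act (1 : Λ)⁻¹ H ∈ R₀}) :
    φ.range.FiniteIndex := by
  classical
  -- a reduced base point `x₀`
  obtain ⟨x, hx⟩ := hXne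
  obtain ⟨γ₀, t₀, -, hx₀⟩ := hcov x hx
  obtain ⟨x₀, hx₀def⟩ : ∃ x₀ : W', x₀ = act (((φ γ₀ : G) : Λ) * t₀)⁻¹ x := ⟨_, rfl⟩
  rw [← hx₀def] at hx₀
  have hx₀X : x₀ ∈ X := by rw [hx₀def]; exact hX _ hx
  -- the finite set of the Siegel property
  obtain ⟨S, hS⟩ : ∃ S : Set P, S = ⋃ t ∈ T, {s : P | (s : Λ) ∈ G ∧ ∃ H ∈ X,
      act ((s : Λ) * t)⁻¹ H ∈ R₀ ∧ act (1 : Λ)⁻¹ H ∈ R₀} := ⟨_, rfl⟩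
  have hSfin : S.Finite := by rw [hS]; exact Set.Finite.biUnion T.finite_toSet hfin
  haveI : Finite S := hSfin.to_subtype
  have hSmem : ∀ s : P, s ∈ S → (s : Λ) ∈ G := by
    intro s hs
    rw [hS] at hs
    obtain ⟨t, -, hst, -⟩ := Set.mem_iUnion₂.1 hs
    exact hst
  -- the surjection `(G ⧸ (P ∩ G)) × S → G ⧸ φ(Γ)`
  haveI : Finite (G ⧸ φ.range) := by
    refine Finite.of_surjective (fun cs : (G ⧸ P.subgroupOf G) × S =>
      (QuotientGroup.mk (cs.1.out * ⟨((cs.2 : P) : Λ), hSmem _ cs.2.2⟩) : G ⧸ φ.range)) fun cq => ?_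
    obtain ⟨g, rfl⟩ := QuotientGroup.mk_surjective cq
    obtain ⟨h₀, hh₀⟩ := QuotientGroup.mk_out_eq_mul (P.subgroupOf G) g
    have hu : ((h₀ : G) : Λ) ∈ P := Subgroup.mem_subgroupOf.1 h₀.2
    -- cover the translate `h₀ · x₀`
    obtain ⟨γ, t, ht, hred⟩ := hcov (act ((h₀ : G) : Λ) x₀) (hX _ hx₀X)
    -- the element `s = h₀⁻¹ (φ γ) ∈ S`
    have hsS : (⟨((h₀ : G) : Λ), hu⟩⁻¹ * ⟨((φ γ : G) : Λ), hφP γ⟩ : P) ∈ S := by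
      rw [hS]
      refine Set.mem_iUnion₂.2 ⟨t, ht, ?_, x₀, hx₀X, ?_, ?_⟩
      · rw [Subgroup.coe_mul, Subgroup.coe_inv]
        exact G.mul_mem (G.inv_mem (h₀ : G).2) (φ γ).2
      · have h : ((((⟨((h₀ : G) : Λ), hu⟩⁻¹ * ⟨((φ γ : G) : Λ), hφP γ⟩ : P)) : Λ) * t)⁻¹ =
            (((φ γ : G) : Λ) * t)⁻¹ * ((h₀ : G) : Λ) := by
          rw [Subgroup.coe_mul, Subgroup.coe_inv]
          group
        rw [h, map_mul]
        exact hred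
      · rw [inv_one, map_one, one_apply_eq_self]
        exact hx₀
    have e1 : ((φ γ⁻¹ : G) : Λ) = (((φ γ : G) : Λ))⁻¹ := by rw [map_inv, Subgroup.coe_inv]
    have e2 : ∀ sG : G, (sG : Λ) = (((h₀ : G) : Λ))⁻¹ * ((φ γ : G) : Λ) →
        ((((g * (h₀ : G) * sG)⁻¹ * g : G)) : Λ) = (((φ γ : G) : Λ))⁻¹ := by
      intro sG hsG
      rw [Subgroup.coe_mul, Subgroup.coe_inv, Subgroup.coe_mul, Subgroup.coe_mul, hsG]
      group
    refine ⟨((QuotientGroup.mk g : G ⧸ P.subgroupOf G), ⟨_, hsS⟩), ?_⟩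
    dsimp only
    rw [hh₀, QuotientGroup.eq]
    refine MonoidHom.mem_range.2 ⟨γ⁻¹, Subtype.ext ?_⟩
    rw [e1]
    exact (e2 _ rfl).symm
  exact Subgroup.finiteIndex_of_finite_quotient

end TwistedQuotient

end Literature.NumberTheory.Automorphic

end
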